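import Summits.Ventures.Crystal3D.Theorems.StickyWulffConstantGenericWallFloorPeriodicLineCrossings
import Summits.Ventures.Crystal3D.Theorems.StickyWulffConstantCoaxialWallLawFrame
import HarnessLib

/-!
# Zigzag lines of a periodic Barlow plate crossing a plane: the flux count `√2·⟨rise⟩·πρ² − O(ρ)` (deliverable 2b)
# (crux `GenericWallFloor`, stmt-Ventures-19480, line `WallLedgerG`; lane T's flux count, cf-p1 ROUTE §86(46))

HONEST FRAMING. Venture `Summits/Ventures/Crystal3D` (cell `crystal3d-full`), helper `--supports` the crux `GenericWallFloor`
(stmt-Ventures-19480) of `route-Ventures-StickyWulffConstant`, registered line `WallLedgerG`, open stub `stub_twoSlabAdhesion`.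
Rung credit only; F-C1 not moved; NOT the stub.  Geometry of the Barlow point sets of `Literature…BarlowStacking`; no packings.

THE BARLOW INSTANTIATION of `periodicLines_crossings_ge` (`…PeriodicLineCrossings`).  Model coordinates (`a = 1`,
`h = √(2/3)`; a moved plate `p ↦ L p + s₀` is pulled back with `ν = L⁻¹e`, `s = L⁻¹s₀`, heights and lateral sizes being
`L`-invariant).  A ZIGZAG of the `p`-periodic stacking `σ` is a path `k ↦ barlowPos σ k (I k) (J k)` — one site per layer,
consecutive sites bonded (`hstep`, e.g. the walker's steepest upper bond per bilayer, `…CapStartBarlowStep`) — whose in-plane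
index drifts periodically (`I (k+p) = I k + δa`, `J (k+p) = J k + δb`); its translates by the layer lattice `a•u + b•v` are
the zigzags `k ↦ barlowPos σ k (I k + a) (J k + b)` (`barlowPos_add_inplane`), pairwise distinct point sets
(`barlowPos_injective`), with common period vector `D = δa•u + δb•v + (W•w + p•layerNormal)`, `W = haggWindow σ 0 p`
(`barlowPos_add_sum_smul`), `det(u, v, D)² = p²/2` (`det_sq_layerFrame_period`: covolume `V = p/√2` whatever the drift) and
`‖D‖ ≤ p`.  Hence

* **`barlowZigzag_crossings_ge`** — if the net ν-rise per period `⟪D, ν⟫` is positive, every finite `T` containing the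
  CROSSING SITES of height `H` (`⟪predecessor + s, ν⟫ < H ≤ ⟪site + s, ν⟫`) of lateral size `‖q‖² − ⟪q,ν⟫² ≤ ρ²` has
  `√2·(⟪D,ν⟫/p)·π·ρ² − √2·π·(8 + 3p)·ρ ≤ #T`;
* `inner_periodVec_eq_sum_rises` — `⟪D, ν⟫ = Σ_{m<p} ⟪γ (k+m+1) − γ (k+m), ν⟫`: the flux coefficient `√2·⟪D,ν⟫/p` is `√2`
  times the MEAN ν-RISE of the zigzag's bonds over a period (lane T's `plateFlux = √2·bilayerRise`, `…TexShadowFluxDefs`,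
  averaged over the period; memo WALKER-COVERAGE-g7 §3 `κ = √2⟨r⟩`: hcp `⟨r⟩ = (r₊ + r₋)/2`, fcc `D = p·(steepest bond)`).

WHAT THIS IS NOT: no walker semantics — that the CAP-START states built on the crossing sites are valid, certified, fuelled and
orbit-free is `…CapStart` / `…CapStartBarlow(Step)` business, and the sealing of their ends lane T's (`…BarlowSealing`);
aperiodic words are not covered (zigzag residual, cf-p1 §86(46)); F-C1 not moved.
-/

noncomputable section

namespace Summit.Ventures.Crystal3D.Theorems

open Summit.Ventures.Crystal3D Finset
open Literature.MathematicalPhysics.StatisticalMechanics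
open scoped InnerProductSpace

/-- In-plane translation of a site: `barlowPos k i j + (a•u + b•v) = barlowPos k (i + a) (j + b)`. -/
theorem barlowPos_add_inplane (a' c : ℝ) (σ : ℤ → ℤ) (k i j a b : ℤ) :
    barlowPos a' c σ k i j + ((a : ℝ) • triangularVec₁ a' + (b : ℝ) • triangularVec₂ a') = barlowPos a' c σ k (i + a) (j + b) := by
  simp only [barlowPos]
  push_cast
  module

/-- Sites of the model stacking (`a = 1`, `h = √(2/3)`) are injectively indexed by `(k, i, j)`. -/
theorem barlowPos_injective (σ : ℤ → ℤ) {k i j k' i' j' : ℤ}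
    (h : barlowPos 1 (Real.sqrt (2 / 3)) σ k i j = barlowPos 1 (Real.sqrt (2 / 3)) σ k' i' j') :
    k = k' ∧ i = i' ∧ j = j' := by
  by_contra hne
  have hne' : (k, i, j) ≠ (k', i', j') := by
    intro h0; simp only [Prod.mk.injEq] at h0; exact hne h0
  have h1 := le_dist_barlowPos 1 (Real.sqrt (2 / 3)) σ (by norm_num) (Real.sqrt_nonneg _) hne'
  rw [h, dist_self] at h1
  have h2 : (0 : ℝ) < min 1 (Real.sqrt (2 / 3)) := lt_min one_pos (Real.sqrt_pos.2 (by norm_num))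
  linarith

/-- **Covolume of a zigzag period frame**: `det(u, v, x•u + y•v + W•w + p•layerNormal)² = p²/2` — the in-plane part of the
period vector does not matter (`V = p/√2`). -/
theorem det_sq_layerFrame_period (x y W p : ℝ) :
    (Matrix.det ![WithLp.ofLp (triangularVec₁ (1 : ℝ)), WithLp.ofLp (triangularVec₂ (1 : ℝ)),
        WithLp.ofLp (x • triangularVec₁ (1 : ℝ) + y • triangularVec₂ 1 +
          (W • barlowOffset 1 + p • layerNormal (Real.sqrt (2 / 3))))]) ^ 2 = p ^ 2 / 2 := by
  have h3 : Real.sqrt 3 ^ 2 = 3 := Real.sq_sqrt (by norm_num)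
  have h23 : Real.sqrt (2 / 3) ^ 2 = 2 / 3 := Real.sq_sqrt (by norm_num)
  have hdet : Matrix.det ![WithLp.ofLp (triangularVec₁ (1 : ℝ)), WithLp.ofLp (triangularVec₂ (1 : ℝ)),
        WithLp.ofLp (x • triangularVec₁ (1 : ℝ) + y • triangularVec₂ 1 +
          (W • barlowOffset 1 + p • layerNormal (Real.sqrt (2 / 3))))] =
      Real.sqrt 3 / 2 * (p * Real.sqrt (2 / 3)) := by
    rw [Matrix.det_fin_three]
    simp [triangularVec₁, triangularVec₂, barlowOffset, layerNormal]
  rw [hdet, mul_pow, mul_pow, div_pow, h3, h23]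
  ring

/-- The period vector is the sum of the bonds of one period: `⟪D, ν⟫ = Σ_{m<p} ⟪γ (k+m+1) − γ (k+m), ν⟫`. -/
theorem inner_periodVec_eq_sum_rises (γ : ℤ → EuclideanSpace ℝ (Fin 3)) (D ν : EuclideanSpace ℝ (Fin 3)) (p : ℕ)
    (hper : ∀ k, γ (k + p) = γ k + D) (k : ℤ) :
    ⟪D, ν⟫_ℝ = ∑ m ∈ Finset.range p, ⟪γ (k + m + 1) - γ (k + m), ν⟫_ℝ := by
  have h : D = γ (k + p) - γ k := by rw [hper]; abel
  have htel : ∑ m ∈ Finset.range p, (γ (k + m + 1) - γ (k + m)) = γ (k + p) - γ k := by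
    have := Finset.sum_range_sub (fun m : ℕ => γ (k + m)) p
    simpa [add_assoc] using this
  rw [← sum_inner, htel, h]

/-- **Zigzag crossings of a periodic Barlow plate (flux count).**  `σ` a `p`-periodic stacking word (`p ≠ 0`), a zigzag
`k ↦ barlowPos σ k (I k) (J k)` with bonded consecutive sites and `p`-periodic index drift `(δa, δb)`, `ν` unit, `s` any
offset, period vector `D = δa•u + δb•v + barlowPeriodVec σ p 2` with `⟪D, ν⟫ > 0`.  If a finite `T` contains every crossing
site `q = barlowPos σ k (I k + a) (J k + b) + s` of height `H` (its zigzag predecessor `barlowPos σ (k−1) (I (k−1) + a)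
(J (k−1) + b) + s` strictly below `H`, itself at or above) with `‖q‖² − ⟪q,ν⟫² ≤ ρ²`, then
`√2·(⟪D,ν⟫/p)·π·ρ² − √2·π·(8 + 3p)·ρ ≤ #T`. -/
theorem barlowZigzag_crossings_ge {σ : ℤ → ℤ} {p : ℕ} (hp : p ≠ 0) (hσp : ∀ i, σ (i + p) = σ i)
    (I J : ℤ → ℤ) (δa δb : ℤ) (hI : ∀ k, I (k + p) = I k + δa) (hJ : ∀ k, J (k + p) = J k + δb)
    (hstep : ∀ k, ‖barlowPos 1 (Real.sqrt (2 / 3)) σ (k + 1) (I (k + 1)) (J (k + 1)) -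
      barlowPos 1 (Real.sqrt (2 / 3)) σ k (I k) (J k)‖ ≤ 1)
    (ν s : EuclideanSpace ℝ (Fin 3)) (hν : ‖ν‖ = 1)
    (hα : 0 < ⟪(δa : ℝ) • triangularVec₁ 1 + (δb : ℝ) • triangularVec₂ 1 + barlowPeriodVec 1 (Real.sqrt (2 / 3)) σ p 2, ν⟫_ℝ)
    (H ρ : ℝ) (hρ : 0 ≤ ρ) (T : Finset (EuclideanSpace ℝ (Fin 3)))
    (hT : ∀ k a b : ℤ,
      ⟪barlowPos 1 (Real.sqrt (2 / 3)) σ (k - 1) (I (k - 1) + a) (J (k - 1) + b) + s, ν⟫_ℝ < H →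
      H ≤ ⟪barlowPos 1 (Real.sqrt (2 / 3)) σ k (I k + a) (J k + b) + s, ν⟫_ℝ →
      ‖barlowPos 1 (Real.sqrt (2 / 3)) σ k (I k + a) (J k + b) + s‖ ^ 2 -
          ⟪barlowPos 1 (Real.sqrt (2 / 3)) σ k (I k + a) (J k + b) + s, ν⟫_ℝ ^ 2 ≤ ρ ^ 2 →
      barlowPos 1 (Real.sqrt (2 / 3)) σ k (I k + a) (J k + b) + s ∈ T) :
    Real.sqrt 2 *
          (⟪(δa : ℝ) • triangularVec₁ 1 + (δb : ℝ) • triangularVec₂ 1 + barlowPeriodVec 1 (Real.sqrt (2 / 3)) σ p 2, ν⟫_ℝ / p) *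
          Real.pi * ρ ^ 2 -
        Real.sqrt 2 * Real.pi * (8 + 3 * p) * ρ ≤ (T.card : ℝ) := by
  set u : EuclideanSpace ℝ (Fin 3) := triangularVec₁ 1 with hu
  set v : EuclideanSpace ℝ (Fin 3) := triangularVec₂ 1 with hv
  set D : EuclideanSpace ℝ (Fin 3) := (δa : ℝ) • u + (δb : ℝ) • v + barlowPeriodVec 1 (Real.sqrt (2 / 3)) σ p 2 with hD
  set γ : ℤ → EuclideanSpace ℝ (Fin 3) := fun k => barlowPos 1 (Real.sqrt (2 / 3)) σ k (I k) (J k) with hγ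
  have hD2 : barlowPeriodVec 1 (Real.sqrt (2 / 3)) σ p 2 =
      (haggWindow σ 0 p : ℝ) • barlowOffset 1 + (p : ℝ) • layerNormal (Real.sqrt (2 / 3)) := by
    simp [barlowPeriodVec]
  have hp0 : (0 : ℝ) < p := Nat.cast_pos.2 (Nat.pos_of_ne_zero hp)
  have h2pos : 0 < Real.sqrt 2 := Real.sqrt_pos.2 (by norm_num)
  have h2sq : Real.sqrt 2 ^ 2 = 2 := Real.sq_sqrt (by norm_num)
  obtain ⟨hnu, hnv, -⟩ := norm_triangularVec_one
  -- periodicity of the zigzag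
  have hper : ∀ k, γ (k + p) = γ k + D := by
    intro k
    simp only [hγ, hD, hI, hJ, hD2]
    have h := barlowPos_add_sum_smul (a := 1) (h := Real.sqrt (2 / 3)) σ hσp k (I k) (J k) δa δb 1
    rw [one_mul, Int.cast_one, one_smul] at h
    rw [← h]
  -- translated zigzags are the in-plane translates
  have hsite : ∀ k a b : ℤ, γ k + (a : ℝ) • u + (b : ℝ) • v = barlowPos 1 (Real.sqrt (2 / 3)) σ k (I k + a) (J k + b) := by
    intro k a b; simp only [hγ, hu, hv]; rw [← barlowPos_add_inplane, add_assoc]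
  -- covolume and norm of the period vector
  have hdet : (Matrix.det ![WithLp.ofLp u, WithLp.ofLp v, WithLp.ofLp D]) ^ 2 = (p / Real.sqrt 2) ^ 2 := by
    rw [hD, hD2, hu, hv, det_sq_layerFrame_period, div_pow, h2sq]
  have hV : 0 < (p : ℝ) / Real.sqrt 2 := div_pos hp0 h2pos
  have hDn : ‖D‖ ≤ p := by
    have h := norm_periodicPath_sub_le γ hstep 0 p
    rw [hper, add_sub_cancel_left] at h; exact h
  have hinj : ∀ k a b k' a' b' : ℤ, γ k + (a : ℝ) • u + (b : ℝ) • v = γ k' + (a' : ℝ) • u + (b' : ℝ) • v →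
      a = a' ∧ b = b' := by
    intro k a b k' a' b' h
    rw [hsite, hsite] at h
    obtain ⟨hk, ha, hb⟩ := barlowPos_injective σ h
    subst hk
    exact ⟨by linarith, by linarith⟩
  have hmain := periodicLines_crossings_ge ν hν γ u v D s p hp hper hstep ((p : ℝ) / Real.sqrt 2) hV hdet hα hinj H ρ hρ T ?_
  swap
  · intro k a b h1 h2 h3
    rw [hsite] at h1 h2 h3 ⊢
    exact hT k a b h1 h2 h3
  -- constants
  set α : ℝ := ⟪D, ν⟫_ℝ with hαdef
  have e1 : α / (p / Real.sqrt 2) = Real.sqrt 2 * (α / p) := by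
    field_simp
  have e2 : Real.pi / (p / Real.sqrt 2) = Real.sqrt 2 * Real.pi / p := by
    field_simp
  rw [e1, e2, hnu, hnv] at hmain
  have herr : Real.sqrt 2 * Real.pi / p * (4 * (1 + 1) * ‖D‖ + ‖D‖ ^ 2 + 2 * ‖D‖ * p) * ρ ≤
      Real.sqrt 2 * Real.pi * (8 + 3 * p) * ρ := by
    apply mul_le_mul_of_nonneg_right _ hρ
    have h1 : 4 * (1 + 1) * ‖D‖ + ‖D‖ ^ 2 + 2 * ‖D‖ * p ≤ (8 + 3 * p) * p := by
      nlinarith [norm_nonneg D]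
    calc Real.sqrt 2 * Real.pi / p * (4 * (1 + 1) * ‖D‖ + ‖D‖ ^ 2 + 2 * ‖D‖ * p)
        ≤ Real.sqrt 2 * Real.pi / p * ((8 + 3 * p) * p) := by
          apply mul_le_mul_of_nonneg_left h1; positivity
      _ = Real.sqrt 2 * Real.pi * (8 + 3 * p) := by field_simp
  linarith

end Summit.Ventures.Crystal3D.Theorems

end
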